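import Mathlib.Algebra.Torsor.Defs
import Mathlib.Algebra.Group.Submonoid.Operations
import Mathlib.Algebra.Group.Subgroup.Ker
import Mathlib.Algebra.Group.TypeTags.Basic
import Mathlib.Algebra.Field.Basic
import Mathlib.Algebra.Ring.Equiv
import Mathlib.Algebra.CharZero.Defs
import Mathlib.Data.Set.Finite.Basic
import Mathlib.Data.PNat.Basic
import Mathlib.Tactic.Abel
import Mathlib.Tactic.NormNum
import HarnessLib

/-!
# [IUTchIII] Example 3.6: concrete representations of global Frobenioids; Remarks 3.6.1, 3.6.2
# (abc-iut cell, layer L6, slice [IUTchIII] §3)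

S. Mochizuki, *Inter-universal Teichmüller theory III*, kurims manuscript (May 2020) of PRIMS
**57** (2021), §3: Example 3.6 "Concrete Representations of Global Frobenioids" pp. 106–108,
Remark 3.6.1 p. 108, Remark 3.6.2 pp. 108–109 (PRIMS offset ≈ +420). The Frobenioid `𝓕⊛_mod` of
arithmetic line bundles on `S_mod` ([IUTchI] Ex. 5.1 (iii)) is given two concrete models: (i) the
"rational function torsor version" `𝓕⊛_MOD` (objects: `F^×_mod`-torsors `T` with local trivializations
`t_v`, `v ∈ 𝕍`), (ii) the "local fractional ideal version" `𝓕⊛_𝔪𝔬𝔡` (objects: collections `{𝔍_v}_{v∈𝕍}` of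
local fractional ideals, almost all trivial), and (iii) their identification.

**Dictionary (faithful, recorded here because it makes (ii) a REAL definition).** For `v ∈ 𝕍` write
`Γ_v := K_v^× / 𝒪^×_{K_v}` ADDITIVELY, with `Γ_v^{≥0}` the image of the nonzero integers `𝒪^▷_{K_v}` (so
`Γ_v ≅ ℤ ⊇ ℕ` via `ord_v` at nonarchimedean `v`, `Γ_v ≅ ℝ` via `-log |·|` at archimedean `v`), and
`β_v : F^×_mod → Γ_v` for the homomorphism "determined by the valuation on `K_v`" (Ex. 3.6 (i)). A local
fractional ideal `𝔍_v = λ · 𝒪_{K_v}` (nonarchimedean: every nonzero finitely generated `𝒪_{K_v}`-submodule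
of `K_v` is of this form; archimedean: "a positive real multiple of `𝒪_{K_v}`") is the same thing as
the class `[λ] ∈ Γ_v`, and `f · 𝔍_{1,v} ⊆ 𝔍_{2,v}` ⟺ `β_v(f) + [λ₁] - [λ₂] ∈ Γ_v^{≥0}`. A trivialization of the
pushed-out torsor `T_v` is the same thing as a `β_v`-equivariant map `t_v : T → Γ_v`. With this
dictionary the objects, elementary morphisms, `f · 𝔍`, tensor powers and compositions of (i), (ii)
are REAL definitions below, and the object/elementary-morphism part of the identification
`𝓕⊛_𝔪𝔬𝔡 → 𝓕⊛_MOD` of (ii)/(iii) ("the arithmetic line bundle obtained from the trivial arithmetic line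
bundle by modifying the integral structure … in the fashion prescribed by `𝔍_v`") is CONSTRUCTED and
its integrality compatibility PROVED. The Frobenioid structures ([FrdI] Def. 1.3 — abc-iut-L1),
"linear morphism"/"Frobenius degree" identifications and the isomorphisms with `𝓕⊛_mod` of [IUTchI]
Ex. 5.1 (iii) (abc-iut-L5-t4) are named `Prop`s over abstract data. Deliberately NOT typed
(C1 'noted'): Remark 3.6.2 (ii)'s methodological sentence "the construction of `𝓕⊛_MOD` is strictly
multiplicative in nature … it is natural to identify `𝓕⊛_MOD` with `𝓕⊛_mod`" beyond the decl
`Remark362ii_identification`. Tag form [claim: Mochizuki2012, status: disputed] (D-0012).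
-/

namespace Literature.IUT.LogThetaLattice

universe u v w

namespace GlobalFrobenioidModels

variable (F : Type u) [Field F] (V : Type v) (Γ : V → Type w) [∀ v, AddCommGroup (Γ v)]
  (nonneg : ∀ v, AddSubmonoid (Γ v)) (β : ∀ v, Additive Fˣ →+ Γ v)

/-! ### Example 3.6 (i): the rational function torsor version `𝓕⊛_MOD` -/

/-- **IUTchIII:Ex3.6(i)** (kurims p.107 l.1) An object `𝓣 = (T, {t_v}_{v∈𝕍})` of `𝓕⊛_MOD`: "(a) an
`F^×_mod`-torsor `T`; (b) for each `v ∈ 𝕍`, a trivialization `t_v` of the torsor `T_v` obtained from `T`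
by executing the 'change of structure group' operation determined by the homomorphism `β_v`
subject to the condition that there exists an element `t ∈ T` such that `t_v` coincides with the
trivialization of `T_v` determined by `t` for all but finitely many `v`" (trivialization of `T_v` =
`β_v`-equivariant map `T → Γ_v`, see the module dictionary). [claim: Mochizuki2012, status: disputed] -/
structure MODObj where
  /-- the underlying `F^×_mod`-torsor (written additively: an `Additive Fˣ`-torsor) -/
  T : Type u
  /-- torsor structure -/
  [instTorsor : AddTorsor (Additive Fˣ) T]
  /-- (b) the local trivializations `t_v`, as `β_v`-equivariant maps `T → Γ_v` -/
  t : ∀ v, T → Γ v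
  /-- `β_v`-equivariance: `t_v(g + x) = β_v(g) + t_v(x)` -/
  equivariant : ∀ v (g : Additive Fˣ) (x : T), t v (g +ᵥ x) = β v g + t v x
  /-- "there exists `t ∈ T` such that `t_v` coincides with the trivialization determined by `t` for all
  but finitely many `v`" -/
  almostAll : ∃ x : T, {v | t v x ≠ 0}.Finite

/-- The torsor structure of an object of `𝓕⊛_MOD` (Ex. 3.6 (i) (a), p. 107). [claim: Mochizuki2012, status: disputed] -/
instance MODObj.torsor (X : MODObj F V Γ β) : AddTorsor (Additive Fˣ) X.T := X.instTorsor

variable {F V Γ nonneg β}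

/-- **IUTchIII:Ex3.6(i)** (kurims p.107 l.10) An *elementary morphism* `𝓣₁ → 𝓣₂` of `𝓕⊛_MOD`: "an
isomorphism `T₁ ≅ T₂` of `F^×_mod`-torsors which is integral at each `v ∈ 𝕍`, i.e., maps the
trivialization `t_{1,v}` to an element of the `𝒪^▷_{K_v}`-orbit of `t_{2,v}`" (`Γ_v^{≥0}` = image of
`𝒪^▷_{K_v}`). [claim: Mochizuki2012, status: disputed] -/
structure ElemHom (T₁ T₂ : MODObj F V Γ β) where
  /-- the underlying bijection of torsors -/
  toEquiv : T₁.T ≃ T₂.T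
  /-- equivariance for the `F^×_mod`-action -/
  map_vadd : ∀ (g : Additive Fˣ) (x : T₁.T), toEquiv (g +ᵥ x) = g +ᵥ toEquiv x
  /-- integrality at each `v`: `t_{2,v}(φ x) - t_{1,v}(x) ∈ Γ_v^{≥0}` -/
  integral : ∀ v (x : T₁.T), T₂.t v (toEquiv x) - T₁.t v x ∈ nonneg v

/-- **IUTchIII:Ex3.6(i)** (kurims p.107 l.14) "There is an evident notion of composition of
elementary morphisms" — CONSTRUCTED (integrality of the composite PROVED: `Γ_v^{≥0}` is a submonoid).
[claim: Mochizuki2012, status: disputed] -/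
def ElemHom.comp {T₁ T₂ T₃ : MODObj F V Γ β} (ψ : ElemHom (nonneg := nonneg) T₂ T₃)
    (φ : ElemHom (nonneg := nonneg) T₁ T₂) : ElemHom (nonneg := nonneg) T₁ T₃ where
  toEquiv := φ.toEquiv.trans ψ.toEquiv
  map_vadd g x := by simp [φ.map_vadd, ψ.map_vadd]
  integral v x := by
    have h := (nonneg v).add_mem (ψ.integral v (φ.toEquiv x)) (φ.integral v x)
    simpa using h

/-- **IUTchIII:Ex3.6(i)** (kurims p.107 l.12) The identity elementary morphism (implicit in "forms a
category"). [claim: Mochizuki2012, status: disputed] -/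
def ElemHom.id (T₁ : MODObj F V Γ β) : ElemHom (nonneg := nonneg) T₁ T₁ where
  toEquiv := Equiv.refl _
  map_vadd _ _ := rfl
  integral v x := by simp [(nonneg v).zero_mem]

/-- **IUTchIII:Ex3.6(i)** (kurims p.107 l.15) "A morphism `𝓣₁ → 𝓣₂` … is defined to consist of a
positive integer `n` and an elementary morphism `(𝓣₁)^{⊗n} → 𝓣₂`", where `𝓣^{⊗n}` is "an evident notion
of tensor powers". The tensor power of a torsor-with-trivializations is taken here as an abstract
operation `tensorPow` (TODO(general form): the pushout `T ×^{F^×, n·} F^×`); a morphism is the pair.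
[claim: Mochizuki2012, status: disputed] -/
structure Hom (tensorPow : MODObj F V Γ β → ℕ+ → MODObj F V Γ β) (T₁ T₂ : MODObj F V Γ β) where
  /-- the Frobenius degree `n` -/
  deg : ℕ+
  /-- the elementary morphism `(𝓣₁)^{⊗n} → 𝓣₂` -/
  elem : ElemHom (nonneg := nonneg) (tensorPow T₁ deg) T₂

/-- **IUTchIII:Ex3.6(i)** (kurims p.107 l.18–29) The printed assertions about `𝓕⊛_MOD`: "`𝓕⊛_MOD` admits a
natural Frobenioid structure [cf. [FrdI], Definition 1.3], for which the base category is the category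
with precisely one arrow …, the elementary morphisms are precisely the linear morphisms, and the
positive integer '`n`' … is the Frobenius degree"; "there exists a natural isomorphism of Frobenioids
`𝓕⊛_mod ≅ 𝓕⊛_MOD` that induces the identity morphism `F^×_mod → F^×_mod` on the associated rational function
monoids [cf. [FrdI], Corollary 4.10]". Typed over abstract data: `Frd` a type of Frobenioids with
`IsoF`, `ratFn` the rational-function-monoid functor, `Fmod` = [IUTchI] Ex. 5.1 (iii)'s `𝓕⊛_mod`
(TODO-merge: abc-iut-L1 [FrdI] Def. 1.3 / Cor. 4.10, abc-iut-L5-t4 [IUTchI] Ex. 5.1).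
[claim: Mochizuki2012, status: disputed] -/
def Ex36i_frobenioidStructure {Frd : Type u} (IsoF : Frd → Frd → Type u) (ratFn : Frd → Type u)
    (onRatFn : ∀ {A B}, IsoF A B → ratFn A → ratFn B) (FMOD Fmod : Frd)
    (eMOD : ratFn FMOD ≃ Fˣ) (emod : ratFn Fmod ≃ Fˣ) : Prop :=
  ∃ φ : IsoF Fmod FMOD, ∀ x, eMOD (onRatFn φ x) = emod x

/-! ### Example 3.6 (ii): the local fractional ideal version `𝓕⊛_𝔪𝔬𝔡` -/

variable (F V Γ β) in
/-- **IUTchIII:Ex3.6(ii)** (kurims p.107 l.31) An object `𝔍 = {𝔍_v}_{v∈𝕍}` of `𝓕⊛_𝔪𝔬𝔡`: "a collection of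
'fractional ideals' `𝔍_v ⊆ K_v` for each `v ∈ 𝕍` — i.e., a finitely generated nonzero `𝒪_{K_v}`-submodule of
`K_v` when `v ∈ 𝕍^non`; a positive real multiple of `𝒪_{K_v} = {λ ∈ K_v | |λ| ≤ 1}` when `v ∈ 𝕍^arc` — such that
`𝔍_v = 𝒪_{K_v}` for all but finitely many `v`", via the dictionary `𝔍_v = λ·𝒪_{K_v} ↔ [λ] ∈ Γ_v` (module
docstring): a finitely supported family of classes. [claim: Mochizuki2012, status: disputed] -/
structure FrakObj where
  /-- `v ↦ [λ_v] ∈ Γ_v` with `𝔍_v = λ_v · 𝒪_{K_v}` -/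
  cls : ∀ v, Γ v
  /-- `𝔍_v = 𝒪_{K_v}` for all but finitely many `v` -/
  finite : {v | cls v ≠ 0}.Finite

/-- **IUTchIII:Ex3.6(ii)** (kurims p.107 l.36) "for any element `f ∈ F^×_mod`, one obtains an object
`f · 𝔍 = {f · 𝔍_v}_{v∈𝕍}`" — CONSTRUCTED; finiteness PROVED from the datum that `β_v(f) = 0` for almost all
`v` (every `f ∈ F^×_mod` is a unit at almost all places: hypothesis `hf`). [claim: Mochizuki2012, status: disputed] -/
def FrakObj.smul (f : Fˣ) (hf : {v | β v (Additive.ofMul f) ≠ 0}.Finite) (J : FrakObj V Γ) :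
    FrakObj V Γ where
  cls v := β v (Additive.ofMul f) + J.cls v
  finite := by
    refine (hf.union J.finite).subset fun v hv => ?_
    by_contra h
    simp only [Set.mem_union, Set.mem_setOf_eq, not_or, not_not] at h
    exact hv (by rw [h.1, h.2, add_zero])

/-- **IUTchIII:Ex3.6(ii)** (kurims p.107 l.38) "for any `n ∈ ℤ`, there is an evident notion of the
`n`-th tensor power `𝔍^{⊗n}` of `𝔍`" — CONSTRUCTED (`𝔍_v^{n} ↔ n·[λ_v]`). [claim: Mochizuki2012, status: disputed] -/
def FrakObj.tensorPow (J : FrakObj V Γ) (n : ℤ) : FrakObj V Γ where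
  cls v := n • J.cls v
  finite := J.finite.subset fun v hv => by
    intro h
    exact hv (by rw [h, zsmul_zero])

/-- **IUTchIII:Ex3.6(ii)** (kurims p.107 l.40 – p.108 l.2) "An elementary morphism `𝔍₁ → 𝔍₂` … is … an
element `f ∈ F^×_mod` that is integral with respect to `𝔍₁` and `𝔍₂` in the sense that `f · 𝔍_{1,v} ⊆ 𝔍_{2,v}`
for each `v ∈ 𝕍`" (⟺ `β_v(f) + [λ_{1,v}] - [λ_{2,v}] ∈ Γ_v^{≥0}`). [claim: Mochizuki2012, status: disputed] -/
def FrakObj.IsElemHom (J₁ J₂ : FrakObj V Γ) (f : Fˣ) : Prop :=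
  ∀ v, β v (Additive.ofMul f) + J₁.cls v - J₂.cls v ∈ nonneg v

/-- **IUTchIII:Ex3.6(ii)** (kurims p.108 l.2) "There is an evident notion of composition of elementary
morphisms" — the product `g · f`; PROVED to be an elementary morphism `𝔍₁ → 𝔍₃`.
[claim: Mochizuki2012, status: disputed] -/
theorem FrakObj.isElemHom_comp {J₁ J₂ J₃ : FrakObj V Γ} {f g : Fˣ}
    (hf : FrakObj.IsElemHom (nonneg := nonneg) (β := β) J₁ J₂ f)
    (hg : FrakObj.IsElemHom (nonneg := nonneg) (β := β) J₂ J₃ g) :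
    FrakObj.IsElemHom (nonneg := nonneg) (β := β) J₁ J₃ (g * f) := by
  intro v
  have h := (nonneg v).add_mem (hg v) (hf v)
  have e : β v (Additive.ofMul (g * f)) = β v (Additive.ofMul g) + β v (Additive.ofMul f) := by
    rw [ofMul_mul, map_add]
  rw [e]
  convert h using 1
  abel

/-- **IUTchIII:Ex3.6(ii)** (kurims p.108 l.3) "A morphism `𝔍₁ → 𝔍₂` … is defined to consist of a positive
integer `n` and an elementary morphism `(𝔍₁)^{⊗n} → 𝔍₂`." [claim: Mochizuki2012, status: disputed] -/
def FrakObj.IsHom (J₁ J₂ : FrakObj V Γ) (n : ℕ+) (f : Fˣ) : Prop :=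
  FrakObj.IsElemHom (nonneg := nonneg) (β := β) (J₁.tensorPow n) J₂ f

/-- **IUTchIII:Ex3.6(ii)** (kurims p.108 l.5–17) The printed assertions about `𝓕⊛_𝔪𝔬𝔡`: "`𝓕⊛_𝔪𝔬𝔡` admits a
natural Frobenioid structure …, for which the base category is the category with precisely one arrow
… the elementary morphisms are precisely the linear morphisms, and … '`n`' … is the Frobenius degree";
"by associating to an object `𝔍` … the arithmetic line bundle on `S_mod` obtained from the trivial
arithmetic line bundle … by modifying the integral structure … at `v ∈ 𝕍` in the fashion prescribed by
`𝔍_v`, … there exists a natural isomorphism of Frobenioids `𝓕⊛_mod ≅ 𝓕⊛_𝔪𝔬𝔡` that induces the identity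
morphism `F^×_mod → F^×_mod` on the associated rational function monoids". Typed over the same abstract
data as `Ex36i_frobenioidStructure`. [claim: Mochizuki2012, status: disputed] -/
def Ex36ii_frobenioidStructure {Frd : Type u} (IsoF : Frd → Frd → Type u) (ratFn : Frd → Type u)
    (onRatFn : ∀ {A B}, IsoF A B → ratFn A → ratFn B) (Ffrak Fmod : Frd)
    (efrak : ratFn Ffrak ≃ Fˣ) (emod : ratFn Fmod ≃ Fˣ) : Prop :=
  ∃ φ : IsoF Fmod Ffrak, ∀ x, efrak (onRatFn φ x) = emod x

/-! ### Example 3.6 (iii): the identification `𝓕⊛_𝔪𝔬𝔡 ≅ 𝓕⊛_MOD` -/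

/-- **IUTchIII:Ex3.6(iii)** (kurims p.108 l.18; with (ii) l.12) The object of `𝓕⊛_MOD` attached to
`𝔍 ∈ 𝓕⊛_𝔪𝔬𝔡` — "the arithmetic line bundle obtained from the trivial arithmetic line bundle … by modifying
the integral structure … at `v` in the fashion prescribed by `𝔍_v`": the trivial torsor `F^×_mod` with
the trivializations `t_v(x) := β_v(x) - [λ_v]`. CONSTRUCTED (the object part of the composite
isomorphism of Frobenioids of (iii)); the almost-all condition PROVED from `𝔍`'s.
[claim: Mochizuki2012, status: disputed] -/
@[reducible] def FrakObj.toMOD (J : FrakObj V Γ) : MODObj F V Γ β where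
  T := Additive Fˣ
  t v x := β v x - J.cls v
  equivariant v g x := by
    simp only [vadd_eq_add, map_add]
    abel
  almostAll := ⟨0, by simpa using J.finite⟩

/-- **IUTchIII:Ex3.6(iii)** (kurims p.108 l.18–22) On elementary morphisms the identification sends
`f : 𝔍₁ → 𝔍₂` to translation by `f` on the trivial torsor; its integrality at every `v` is EXACTLY the
condition `f · 𝔍_{1,v} ⊆ 𝔍_{2,v}` — CONSTRUCTED/PROVED. ("induces the identity morphism `F^×_mod → F^×_mod` on
the associated rational function monoids": the element `f` is sent to itself.)
[claim: Mochizuki2012, status: disputed] -/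
def FrakObj.toMODHom {J₁ J₂ : FrakObj V Γ} (f : Fˣ)
    (hf : FrakObj.IsElemHom (nonneg := nonneg) (β := β) J₁ J₂ f) :
    ElemHom (nonneg := nonneg) (J₁.toMOD (F := F) (β := β)) (J₂.toMOD (F := F) (β := β)) where
  toEquiv := Equiv.addLeft (Additive.ofMul f)
  map_vadd g x := by
    change Additive.ofMul f + (g + x) = g + (Additive.ofMul f + x)
    abel
  integral v x := by
    change β v (Additive.ofMul f + x) - J₂.cls v - (β v x - J₁.cls v) ∈ nonneg v
    rw [map_add]
    convert hf v using 1
    abel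

/-- **IUTchIII:Ex3.6(iii)** (kurims p.108 l.22–27) "although the above isomorphism of Frobenioids is not
necessarily determined by the condition that it induce the identity morphism on `F^×_mod`, the induced
isomorphism between the respective perfections [hence also on realifications] of `𝓕⊛_𝔪𝔬𝔡`, `𝓕⊛_MOD` is
completely determined by this condition." Typed over abstract data (`perf` = perfection, `IsoF`,
`onRatFn` as before): any two isomorphisms inducing the identity on `F^×_mod` have equal
perfections. [claim: Mochizuki2012, status: disputed] -/
def Ex36iii_perfectionDetermined {Frd : Type u} (IsoF : Frd → Frd → Type u) (ratFn : Frd → Type u)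
    (onRatFn : ∀ {A B}, IsoF A B → ratFn A → ratFn B) (perf : Frd → Frd)
    (onPerf : ∀ {A B}, IsoF A B → IsoF (perf A) (perf B)) (Ffrak FMOD : Frd)
    (efrak : ratFn Ffrak ≃ Fˣ) (eMOD : ratFn FMOD ≃ Fˣ) : Prop :=
  ∀ φ ψ : IsoF Ffrak FMOD, (∀ x, eMOD (onRatFn φ x) = efrak x) →
    (∀ x, eMOD (onRatFn ψ x) = efrak x) → onPerf φ = onPerf ψ

/-! ### Remarks 3.6.1, 3.6.2 -/

/-- **IUTchIII:Rmk3.6.1** (kurims p.108 l.28) "the various homomorphisms `β_v`, for `v ∈ 𝕍`, may be thought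
of, alternatively, as a collection of subquotients of the perfection `(F^×_mod)^{pf}` of `F^×_mod` — each
of which is equipped with a submonoid of 'nonnegative elements' — that are completely determined by
the ring structure of the field `F_mod`". Typed: the subquotient datum at `v` = (kernel of `β_v`, the
preimage of `Γ_v^{≥0}`), as a pair of sub-objects of `F^×_mod` (the perfection is not needed to record
the datum); the "completely determined by the ring structure" clause is `Remark361_determined`.
[claim: Mochizuki2012, status: disputed] -/
def Remark361_subquotientDatum (v : V) : AddSubgroup (Additive Fˣ) × AddSubmonoid (Additive Fˣ) :=
  ((β v).ker, (nonneg v).comap (β v))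

/-- **IUTchIII:Rmk3.6.1** (kurims p.108 l.31) "… completely determined by the ring structure of the field
`F_mod` [i.e., equipped with its structure as the field of moduli of `X_F`]": any ring automorphism of
`F_mod` permutes the family of subquotient data `{(ker β_v, β_v^{-1}Γ_v^{≥0})}_v` (typed form of
"determined by the ring structure"). [claim: Mochizuki2012, status: disputed] -/
def Remark361_determined : Prop :=
  ∀ σ : F ≃+* F, ∀ v, ∃ v', ∀ f : Fˣ,
    (Additive.ofMul f ∈ (Remark361_subquotientDatum (nonneg := nonneg) (β := β) v).2 ↔
      Additive.ofMul (Units.map σ.toRingHom.toMonoidHom f) ∈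
        (Remark361_subquotientDatum (nonneg := nonneg) (β := β) v').2)

variable (F) in
/-- **IUTchIII:Rmk3.6.2(i)** (kurims p.109 l.6) The "fundamental property" of the rational function monoid:
"[the union with `{0}` of] `F^×_mod` admits a natural additive structure", i.e. is closed under the
addition of the field; typed for a multiplicative subset `S ⊆ F^×` as: `S ∪ {0}` (viewed in `F`) is
closed under `+`. [claim: Mochizuki2012, status: disputed] -/
def IsAdditivelyClosed (S : Set F) : Prop := ∀ a ∈ S ∪ {0}, ∀ b ∈ S ∪ {0}, a + b ∈ S ∪ {0}

/-- **IUTchIII:Rmk3.6.2(i)** (kurims p.109 l.6) `F^×_mod ∪ {0} = F_mod` is additively closed — PROVED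
(trivially: it is all of `F_mod`). [claim: Mochizuki2012, status: disputed] -/
theorem isAdditivelyClosed_units : IsAdditivelyClosed F {x : F | x ≠ 0} := by
  intro a _ b _
  by_cases h : a + b = 0
  · exact Or.inr h
  · exact Or.inl h

/-- **IUTchIII:Rmk3.6.2(i)** (kurims p.109 l.9–13) "this property is not satisfied by … (b) subgroups
`Γ ⊆ F^×_mod` — such as, for instance, the trivial subgroup `{1}` …" — PROVED for `{1}` in characteristic
`≠ 2` (number fields): `1 + 1 ∉ {0, 1}`. (The other printed instances — (a) the rational function
monoids of the perfection or realification, (b) the `S`-units for `S ≠ ∅` finite — are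
`Remark362i_Sunits`.) [claim: Mochizuki2012, status: disputed] -/
theorem not_isAdditivelyClosed_one [CharZero F] : ¬ IsAdditivelyClosed F ({1} : Set F) := by
  intro h
  have h2 := h 1 (Or.inl rfl) 1 (Or.inl rfl)
  simp only [Set.union_singleton, Set.mem_insert_iff, Set.mem_singleton_iff] at h2
  rcases h2 with h2 | h2 <;> norm_num at h2

/-- **IUTchIII:Rmk3.6.2(i)** (kurims p.109 l.11) "(b) … the subgroup of `S`-units, for `S ⊆ 𝕍_mod` a
nonempty finite subset — that do not arise as the multiplicative group of some subfield of `F_mod`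
[cf. [AbsTopIII], Remark 5.10.2, (iv)]" do not satisfy the fundamental property: typed for an
abstract `S`-unit subgroup `U_S ⊊ F^×` (a proper subgroup containing all `n · 1`, `n ≥ 1`, would be
forced by additive closure — the printed reason is that `U_S ∪ {0}` is not a subfield).
[claim: Mochizuki2012, status: disputed] -/
def Remark362i_Sunits (US : Subgroup Fˣ) : Prop :=
  US ≠ ⊤ → ¬ IsAdditivelyClosed F {x : F | ∃ u ∈ US, (u : F) = x}

/-- **IUTchIII:Rmk3.6.2(ii)** (kurims p.109 l.28–35) "whereas the construction of `𝓕⊛_𝔪𝔬𝔡` depends on the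
additive structure of `F^×_mod` in an essential way, the construction of `𝓕⊛_MOD` is strictly multiplicative
in nature … it is natural to identify `𝓕⊛_MOD` with `𝓕⊛_mod` via the natural isomorphism of Frobenioids of
Example 3.6, (i)." Typed: the identification map on objects from the fractional-ideal model to the
torsor model is `FrakObj.toMOD`; recorded here as the statement that it is injective on objects
(distinct ideal classes give distinct trivialization data) — PROVED. [claim: Mochizuki2012, status: disputed] -/
theorem Remark362ii_identification (J₁ J₂ : FrakObj V Γ)
    (h : (J₁.toMOD (F := F) (β := β)).t = (J₂.toMOD (F := F) (β := β)).t) : J₁.cls = J₂.cls := by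
  funext v
  have h' := congrFun (congrFun h v) (0 : Additive Fˣ)
  simpa [FrakObj.toMOD] using h'

/-! ### Remark 3.6.2 (i) (b) — corrected typing of the `S`-unit clause (appended; RQ7 finding) -/

/-- **IUTchIII:Rmk3.6.2(i)** (kurims p.109 l.11) CORRECTED typing of clause (b) (RQ7 audit finding,
abc-iut-L6-t15, INBOX 2026-08-25T19:24:34Z, with kernel-checked witness
`HOME/staging/L6/L6-t15/Remark362iWitness.lean`: the earlier `Remark362i_Sunits`, which hypothesises only
`US ≠ ⊤`, is FALSE AS TYPED — in `F = ℚ` the positive rationals are a proper subgroup whose union with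
`{0}` IS additively closed). The printed instance is "the subgroup of `S`-units, for `S ⊆ 𝕍_mod` a
nonempty finite subset"; what makes it fail the fundamental property is that SOME positive integer is not
an `S`-unit (a rational prime below no place of `S`). Typed with exactly that hypothesis — and PROVED
below. [claim: Mochizuki2012, status: disputed] -/
def Remark362i_Sunits' (US : Subgroup Fˣ) : Prop :=
  (∃ n : ℕ, 0 < n ∧ ∀ u ∈ US, (u : F) ≠ n) → ¬ IsAdditivelyClosed F {x : F | ∃ u ∈ US, (u : F) = x}

/-- **IUTchIII:Rmk3.6.2(i)** (kurims p.109 l.9–13) — PROOF of the corrected clause (b): if `US ∪ {0}` were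
additively closed then, since `1 ∈ US`, every positive integer `n · 1` would lie in `US ∪ {0}`, hence
(characteristic `0`) in `US` — contradicting the existence of a positive integer that is not in `US`.
[claim: Mochizuki2012, status: disputed] -/
theorem Remark362i_Sunits'_holds [CharZero F] (US : Subgroup Fˣ) : Remark362i_Sunits' (F := F) US := by
  rintro ⟨n, hn, hnot⟩ hclosed
  -- every natural number lies in `US ∪ {0}` (viewed in `F`)
  have hall : ∀ m : ℕ, (m : F) ∈ {x : F | ∃ u ∈ US, (u : F) = x} ∪ {0} := by
    intro m
    induction m with
    | zero => exact Or.inr (by simp)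
    | succ m ih =>
      have h1 : ((1 : ℕ) : F) ∈ {x : F | ∃ u ∈ US, (u : F) = x} ∪ {0} :=
        Or.inl ⟨1, US.one_mem, by simp⟩
      have := hclosed _ ih _ h1
      simpa [Nat.cast_succ] using this
  rcases hall n with ⟨u, hu, hun⟩ | h0
  · exact hnot u hu hun
  · exact (Nat.cast_ne_zero.mpr hn.ne') h0

end GlobalFrobenioidModels

end Literature.IUT.LogThetaLattice
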